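import Literature.Analysis.FluidPDE.ParabolicComparison
import Literature.Analysis.PDE.HopfLemmas
import Literature.Analysis.Calculus.DivCurlPlane
import Summits.NavierStokesRegularity.NavierStokesRegularity.Theorems.StrainDoorsQuadrupole
import HarnessLib

/-!
# Strain doors — RIGIDITY OF FAVOURABLE SEGREGATION (the pointwise sign hypothesis of door D11 is rigid) — PART 1/2 (§22, pure calculus)

Door D11 «MagicConeDoor» (R48) asks, at every charged near-record strain point `(x,e)`, for the POINTWISE
favourable segregation of the Q-excess: `K_ee(x − y)(q(y) − q(x)) ≥ 0` for all `y`, where inside the inner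
radius `K_ee(z) = (|z|² − 3⟨z,e⟩²)/(4π|z|⁵)` changes sign across the magic cone `3⟨z,e⟩² = |z|²`.  This file
proves that the pointwise sign is RIGID:

* §22 (pure calculus, any `C²` scalar field `q` on `ℝ³`, unit `e`, radius `ρ > 0`).  If `q(x+z) ≤ q(x)` for
  `z` in the open inner cone and `q(x+z) ≥ q(x)` for `z` in the open outer cone (`|z| < ρ`), then
  `∇q(x) = 0` (`fderiv_eq_zero_of_coneSegregated`), the Hessian is the uniaxial quadrupole
  `D²q(x)(v,v) = (a/2)(3⟨v,e⟩² − |v|²)` with `a = D²q(x)(e,e) ≤ 0` (`hess_eq_of_coneSegregated`,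
  `hess_self_nonpos_of_coneSegregated`), and hence `Δq(x) = 0` (`laplacian_eq_zero_of_coneSegregated`).
* §23 (kernel form).  D11's hypothesis (i) with `0 < r₀ < r₁` implies the cone form with `ρ = r₀`
  (`coneSegregated_of_segregated`, from the tree's `newtonNearHess_self_eq_quadrupole`).
* §24 (Navier–Stokes).  At a point of favourable segregation of a classical solution: `∇(Δp) = 0`,
  `Δ²p = 0` and `D²(Δp)` is the compressed uniaxial quadrupole along `e` (`q = Δp`); if (i) holds at every
  point of a ball then `q = Δp` is CONSTANT on the ball (`qDensity_eq_of_segregated_on_ball`); and under the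
  full hypothesis of D11 at a time `t`, `q` is locally constant around every strictly sub-tolerance charged
  almost-record strain point (`qDensity_locallyConst_of_D11_hypothesis`) — the door's antecedent forces the
  near field of the record region to be «pressure-Laplacian flat», as in a pure stretched shear layer.

* §25 (modulo analyticity).  With real-analyticity and integrability of `q(t,·)` as explicit hypotheses (true for mild
  solutions at `t > 0` by Masuda/Kahane/Foias–Temam, not typed here), D11's segregation hypothesis at time `t` forces
  `q(t,·) ≡ 0` on `ℝ³` and `Δp(t,·) ≡ 0` (`qDensity_eq_zero_of_D11_hypothesis_of_analytic`).

LANDING NOTE (ns-s29-p2 g5): nsreg-p1 g34's ROUND-49 text `StrainDoorsSegregationRigidity.lean` (sha16 289ea2a845865ffa, 583 l.)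
exceeds the gate's 400-line cap and is landed BY SECTION in two modules with every declaration byte-identical: PART 1 =
§22 (`Theorems/StrainDoorsSegregationRigidity`), PART 2 = §23–§25 (`Theorems/StrainDoorsSegregationRigidityNS`, imports PART 1).
`--supports stmt-NavierStokesRegularity-0056 --as helper`. HONEST FRAME: rigidity of a door HYPOTHESIS; 0056 / 10661 / NS regularity NOT proved.
Nothing here is a regularity statement; it is negative knowledge about the strength of a door hypothesis.
-/

noncomputable section

open MeasureTheory Set Function Filter InnerProductSpace Metric
open scoped RealInnerProductSpace Laplacian ContDiff Topology
open Real Literature.Analysis.FluidPDE Literature.Analysis.FluidPDE.VorticityDirectionDynamics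

set_option linter.dupNamespace false
set_option linter.unusedSectionVars false

namespace Summit.NavierStokesRegularity.NavierStokesRegularity.Theorems.StrainDoors

/-! ## §22  Cone segregation of a `C²` scalar field forces a critical point with a uniaxial trace-free Hessian -/

section Cone

variable {q : EuclideanSpace ℝ (Fin 3) → ℝ} {x e : EuclideanSpace ℝ (Fin 3)} {ρ : ℝ}

/-- support: along an IN-CONE direction `v` (`|v|² < 3⟨v,e⟩²`) the restriction `s ↦ q(x + s v)` has a local
maximum at `0`. -/
theorem isLocalMax_line_of_coneSegregated (hρ : 0 < ρ)
    (hseg : ∀ z : EuclideanSpace ℝ (Fin 3), ‖z‖ < ρ →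
      (‖z‖ ^ 2 < 3 * ⟪z, e⟫ ^ 2 → q (x + z) ≤ q x) ∧ (3 * ⟪z, e⟫ ^ 2 < ‖z‖ ^ 2 → q x ≤ q (x + z)))
    {v : EuclideanSpace ℝ (Fin 3)} (hv : ‖v‖ ^ 2 < 3 * ⟪v, e⟫ ^ 2) :
    IsLocalMax (fun s : ℝ => q (x + s • v)) 0 := by
  have hv0 : v ≠ 0 := by rintro rfl; simp at hv
  have hvn : 0 < ‖v‖ := norm_pos_iff.2 hv0
  have hmem : Ioo (-(ρ / ‖v‖)) (ρ / ‖v‖) ∈ 𝓝 (0 : ℝ) :=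
    Ioo_mem_nhds (by rw [neg_lt_zero]; positivity) (by positivity)
  show ∀ᶠ s in 𝓝 (0 : ℝ), q (x + s • v) ≤ q (x + (0 : ℝ) • v)
  filter_upwards [hmem] with s hs
  rw [zero_smul, add_zero]
  by_cases hs0 : s = 0
  · simp [hs0]
  have hsabs : |s| < ρ / ‖v‖ := abs_lt.2 ⟨hs.1, hs.2⟩
  have hz : ‖s • v‖ < ρ := by
    rw [norm_smul, Real.norm_eq_abs]
    calc |s| * ‖v‖ < ρ / ‖v‖ * ‖v‖ := by gcongr
      _ = ρ := div_mul_cancel₀ ρ hvn.ne'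
  have hin : ‖s • v‖ ^ 2 < 3 * ⟪s • v, e⟫ ^ 2 := by
    rw [norm_smul, real_inner_smul_left, Real.norm_eq_abs, mul_pow, mul_pow, sq_abs]
    have hs2 : 0 < s ^ 2 := by positivity
    nlinarith
  exact (hseg (s • v) hz).1 hin

/-- support: along an OUT-OF-CONE direction `v` (`3⟨v,e⟩² < |v|²`) the restriction `s ↦ q(x + s v)` has a local
minimum at `0`. -/
theorem isLocalMin_line_of_coneSegregated (hρ : 0 < ρ)
    (hseg : ∀ z : EuclideanSpace ℝ (Fin 3), ‖z‖ < ρ →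
      (‖z‖ ^ 2 < 3 * ⟪z, e⟫ ^ 2 → q (x + z) ≤ q x) ∧ (3 * ⟪z, e⟫ ^ 2 < ‖z‖ ^ 2 → q x ≤ q (x + z)))
    {v : EuclideanSpace ℝ (Fin 3)} (hv : 3 * ⟪v, e⟫ ^ 2 < ‖v‖ ^ 2) :
    IsLocalMin (fun s : ℝ => q (x + s • v)) 0 := by
  have hv0 : v ≠ 0 := by
    rintro rfl; simp at hv
  have hvn : 0 < ‖v‖ := norm_pos_iff.2 hv0
  have hmem : Ioo (-(ρ / ‖v‖)) (ρ / ‖v‖) ∈ 𝓝 (0 : ℝ) :=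
    Ioo_mem_nhds (by rw [neg_lt_zero]; positivity) (by positivity)
  show ∀ᶠ s in 𝓝 (0 : ℝ), q (x + (0 : ℝ) • v) ≤ q (x + s • v)
  filter_upwards [hmem] with s hs
  rw [zero_smul, add_zero]
  by_cases hs0 : s = 0
  · simp [hs0]
  have hsabs : |s| < ρ / ‖v‖ := abs_lt.2 ⟨hs.1, hs.2⟩
  have hz : ‖s • v‖ < ρ := by
    rw [norm_smul, Real.norm_eq_abs]
    calc |s| * ‖v‖ < ρ / ‖v‖ * ‖v‖ := by gcongr
      _ = ρ := div_mul_cancel₀ ρ hvn.ne'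
  have hout : 3 * ⟪s • v, e⟫ ^ 2 < ‖s • v‖ ^ 2 := by
    rw [norm_smul, real_inner_smul_left, Real.norm_eq_abs, mul_pow, mul_pow, sq_abs]
    have hs2 : 0 < s ^ 2 := by positivity
    nlinarith
  exact (hseg (s • v) hz).2 hout

/-- support: the differential of `q` at `x` kills every in-cone and every out-of-cone direction. -/
theorem fderiv_apply_eq_zero_of_coneSegregated (hq : Differentiable ℝ q) (hρ : 0 < ρ)
    (hseg : ∀ z : EuclideanSpace ℝ (Fin 3), ‖z‖ < ρ →
      (‖z‖ ^ 2 < 3 * ⟪z, e⟫ ^ 2 → q (x + z) ≤ q x) ∧ (3 * ⟪z, e⟫ ^ 2 < ‖z‖ ^ 2 → q x ≤ q (x + z)))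
    {v : EuclideanSpace ℝ (Fin 3)} (hv : ‖v‖ ^ 2 < 3 * ⟪v, e⟫ ^ 2 ∨ 3 * ⟪v, e⟫ ^ 2 < ‖v‖ ^ 2) :
    fderiv ℝ q x v = 0 := by
  have h := hasDerivAt_comp_line hq x v 0
  rw [zero_smul, add_zero] at h
  rcases hv with hv | hv
  · exact (isLocalMax_line_of_coneSegregated hρ hseg hv).hasDerivAt_eq_zero h
  · exact (isLocalMin_line_of_coneSegregated hρ hseg hv).hasDerivAt_eq_zero h

/-- ★ RIGIDITY I: cone segregation at `x` along a unit `e` forces `∇q(x) = 0`. -/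
theorem fderiv_eq_zero_of_coneSegregated (hq : Differentiable ℝ q) (he : ‖e‖ = 1) (hρ : 0 < ρ)
    (hseg : ∀ z : EuclideanSpace ℝ (Fin 3), ‖z‖ < ρ →
      (‖z‖ ^ 2 < 3 * ⟪z, e⟫ ^ 2 → q (x + z) ≤ q x) ∧ (3 * ⟪z, e⟫ ^ 2 < ‖z‖ ^ 2 → q x ≤ q (x + z))) :
    fderiv ℝ q x = 0 := by
  ext w
  set L := fderiv ℝ q x with hL
  have hee : ⟪e, e⟫ = 1 := by rw [real_inner_self_eq_norm_sq, he]; norm_num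
  have hLe : L e = 0 :=
    fderiv_apply_eq_zero_of_coneSegregated hq hρ hseg (Or.inl (by rw [he, hee]; norm_num))
  set w' : EuclideanSpace ℝ (Fin 3) := w - ⟪w, e⟫ • e with hw'
  have hw'e : ⟪w', e⟫ = 0 := by
    rw [hw', inner_sub_left, real_inner_smul_left, hee]; ring
  have hLw' : L w' = 0 := by
    by_cases h0 : w' = 0
    · rw [h0, map_zero]
    · refine fderiv_apply_eq_zero_of_coneSegregated hq hρ hseg (Or.inr ?_)
      have h1 : 0 < ‖w'‖ ^ 2 := pow_pos (norm_pos_iff.2 h0) 2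
      rw [hw'e]; linarith
  have hw : w = ⟪w, e⟫ • e + w' := by rw [hw']; abel
  calc L w = ⟪w, e⟫ * L e + L w' := by
        conv_lhs => rw [hw]
        rw [map_add, map_smul, smul_eq_mul]
    _ = 0 := by rw [hLe, hLw']; ring
    _ = (0 : EuclideanSpace ℝ (Fin 3) →L[ℝ] ℝ) w := rfl

/-- support: the second derivative of the line restriction at `0` is the Hessian quadratic form. -/
theorem deriv_deriv_line_eq_hess (hq : ContDiff ℝ 2 q) (x v : EuclideanSpace ℝ (Fin 3)) :
    deriv (deriv (fun s : ℝ => q (x + s • v))) 0 = fderiv ℝ (fderiv ℝ q) x v v := by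
  have hqd : Differentiable ℝ q := hq.differentiable two_ne_zero
  have h1 : deriv (fun s : ℝ => q (x + s • v)) = fun s => fderiv ℝ q (x + s • v) v :=
    funext fun s => (hasDerivAt_comp_line hqd x v s).deriv
  have hD1 : ContDiff ℝ 1 fun z => fderiv ℝ q z v :=
    Literature.Analysis.Calculus.contDiff_one_fderiv_apply_const hq v
  rw [h1, ← Literature.Analysis.Calculus.fderiv_fderiv_apply_const hq x v v]
  have h2 := hasDerivAt_comp_line (W := fun z => fderiv ℝ q z v) (hD1.differentiable one_ne_zero) x v 0
  rw [zero_smul, add_zero] at h2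
  exact h2.deriv

/-- support: the Hessian is `≤ 0` on in-cone directions. -/
theorem hess_nonpos_of_coneSegregated (hq : ContDiff ℝ 2 q) (hρ : 0 < ρ)
    (hseg : ∀ z : EuclideanSpace ℝ (Fin 3), ‖z‖ < ρ →
      (‖z‖ ^ 2 < 3 * ⟪z, e⟫ ^ 2 → q (x + z) ≤ q x) ∧ (3 * ⟪z, e⟫ ^ 2 < ‖z‖ ^ 2 → q x ≤ q (x + z)))
    {v : EuclideanSpace ℝ (Fin 3)} (hv : ‖v‖ ^ 2 < 3 * ⟪v, e⟫ ^ 2) :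
    fderiv ℝ (fderiv ℝ q) x v v ≤ 0 := by
  rw [← deriv_deriv_line_eq_hess hq x v]
  have hc : ContinuousAt (fun s : ℝ => q (x + s • v)) 0 :=
    (hq.continuous.comp (by fun_prop)).continuousAt
  exact IsLocalMax.deriv_deriv_nonpos (isLocalMax_line_of_coneSegregated hρ hseg hv) hc

/-- support: the Hessian is `≥ 0` on out-of-cone directions. -/
theorem hess_nonneg_of_coneSegregated (hq : ContDiff ℝ 2 q) (hρ : 0 < ρ)
    (hseg : ∀ z : EuclideanSpace ℝ (Fin 3), ‖z‖ < ρ →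
      (‖z‖ ^ 2 < 3 * ⟪z, e⟫ ^ 2 → q (x + z) ≤ q x) ∧ (3 * ⟪z, e⟫ ^ 2 < ‖z‖ ^ 2 → q x ≤ q (x + z)))
    {v : EuclideanSpace ℝ (Fin 3)} (hv : 3 * ⟪v, e⟫ ^ 2 < ‖v‖ ^ 2) :
    0 ≤ fderiv ℝ (fderiv ℝ q) x v v := by
  rw [← deriv_deriv_line_eq_hess hq x v]
  have hc : ContinuousAt (fun s : ℝ => q (x + s • v)) 0 :=
    (hq.continuous.comp (by fun_prop)).continuousAt
  exact Literature.Analysis.PDE.deriv_deriv_nonneg_of_isLocalMin (isLocalMin_line_of_coneSegregated hρ hseg hv) hc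

/-- support (pure ℝ): a quadratic `a + B t + c t²` that is `≤ 0` for `t² < 2` and `≥ 0` for `t² > 2`
vanishes at `t = ±√2`; hence `B = 0` and `a + 2c = 0`. -/
theorem quad_coeffs_of_sign_change {a B c : ℝ} (h1 : ∀ t : ℝ, t ^ 2 < 2 → a + B * t + c * t ^ 2 ≤ 0)
    (h2 : ∀ t : ℝ, 2 < t ^ 2 → 0 ≤ a + B * t + c * t ^ 2) : B = 0 ∧ a + 2 * c = 0 := by
  set g : ℝ → ℝ := fun t => a + B * t + c * t ^ 2 with hg
  have hgc : Continuous g := by fun_prop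
  have hs2 : (0 : ℝ) < Real.sqrt 2 := Real.sqrt_pos.2 (by norm_num)
  have hsq : Real.sqrt 2 ^ 2 = 2 := Real.sq_sqrt (by norm_num)
  -- the closed sets `{g ≤ 0}` and `{0 ≤ g}`
  have hC1 : IsClosed {t : ℝ | g t ≤ 0} := isClosed_le hgc continuous_const
  have hC2 : IsClosed {t : ℝ | 0 ≤ g t} := isClosed_le continuous_const hgc
  -- `g ≤ 0` on `Ioo (-√2) √2`, hence on its closure `Icc`
  have hsub1 : Ioo (-Real.sqrt 2) (Real.sqrt 2) ⊆ {t : ℝ | g t ≤ 0} := by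
    intro t ht
    have : t ^ 2 < 2 := by
      have h := abs_lt.2 ⟨ht.1, ht.2⟩
      have hta : 0 ≤ |t| := abs_nonneg t
      nlinarith [sq_abs t, hsq]
    exact h1 t this
  have hcl1 : Icc (-Real.sqrt 2) (Real.sqrt 2) ⊆ {t : ℝ | g t ≤ 0} := by
    rw [← closure_Ioo (by linarith : (-Real.sqrt 2) ≠ Real.sqrt 2)]
    exact closure_minimal hsub1 hC1
  -- `0 ≤ g` on `Ioi √2` and on `Iio (-√2)`, hence on their closures
  have hsub2 : Ioi (Real.sqrt 2) ⊆ {t : ℝ | 0 ≤ g t} := by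
    intro t ht
    have ht' : Real.sqrt 2 < t := ht
    have : 2 < t ^ 2 := by nlinarith
    exact h2 t this
  have hsub3 : Iio (-Real.sqrt 2) ⊆ {t : ℝ | 0 ≤ g t} := by
    intro t ht
    have ht' : t < -Real.sqrt 2 := ht
    have : 2 < t ^ 2 := by nlinarith
    exact h2 t this
  have hcl2 : Ici (Real.sqrt 2) ⊆ {t : ℝ | 0 ≤ g t} := by
    rw [← closure_Ioi]
    exact closure_minimal hsub2 hC2
  have hcl3 : Iic (-Real.sqrt 2) ⊆ {t : ℝ | 0 ≤ g t} := by
    rw [← closure_Iio]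
    exact closure_minimal hsub3 hC2
  have gp : g (Real.sqrt 2) = 0 :=
    le_antisymm (hcl1 ⟨by linarith, le_rfl⟩) (hcl2 Set.self_mem_Ici)
  have gm : g (-Real.sqrt 2) = 0 :=
    le_antisymm (hcl1 ⟨le_rfl, by linarith⟩) (hcl3 Set.self_mem_Iic)
  simp only [hg] at gp gm
  rw [neg_sq] at gm
  rw [hsq] at gp gm
  constructor
  · nlinarith
  · nlinarith

/-- support: on a direction `w ⟂ e` the mixed Hessian terms cancel and the Hessian is `−(a/2)|w|²`,
`a = D²q(x)(e,e)`. -/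
theorem hess_perp_of_coneSegregated (hq : ContDiff ℝ 2 q) (he : ‖e‖ = 1) (hρ : 0 < ρ)
    (hseg : ∀ z : EuclideanSpace ℝ (Fin 3), ‖z‖ < ρ →
      (‖z‖ ^ 2 < 3 * ⟪z, e⟫ ^ 2 → q (x + z) ≤ q x) ∧ (3 * ⟪z, e⟫ ^ 2 < ‖z‖ ^ 2 → q x ≤ q (x + z)))
    {w : EuclideanSpace ℝ (Fin 3)} (hw : ⟪w, e⟫ = 0) :
    fderiv ℝ (fderiv ℝ q) x e w + fderiv ℝ (fderiv ℝ q) x w e = 0 ∧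
      fderiv ℝ (fderiv ℝ q) x w w = -(fderiv ℝ (fderiv ℝ q) x e e / 2) * ‖w‖ ^ 2 := by
  set H := fderiv ℝ (fderiv ℝ q) x with hH
  have hee : ⟪e, e⟫ = 1 := by rw [real_inner_self_eq_norm_sq, he]; norm_num
  by_cases hw0 : w = 0
  · simp [hw0]
  have hwn : 0 < ‖w‖ := norm_pos_iff.2 hw0
  -- the unit vector `m = w/|w|` (kept opaque)
  obtain ⟨m, hm⟩ : ∃ m : EuclideanSpace ℝ (Fin 3), m = ‖w‖⁻¹ • w := ⟨_, rfl⟩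
  have hme : ⟪m, e⟫ = 0 := by rw [hm, real_inner_smul_left, hw, mul_zero]
  have hem : ⟪e, m⟫ = 0 := by rw [real_inner_comm]; exact hme
  have hmn : ‖m‖ = 1 := by
    rw [hm, norm_smul, norm_inv, norm_norm, inv_mul_cancel₀ hwn.ne']
  have hmm : ⟪m, m⟫ = 1 := by rw [real_inner_self_eq_norm_sq, hmn]; norm_num
  -- expansion of the quadratic form on `e + t m`
  have hexp : ∀ t : ℝ, H (e + t • m) (e + t • m) = H e e + (H e m + H m e) * t + H m m * t ^ 2 := by
    intro t
    simp only [map_add, map_smul, add_apply, smul_apply, smul_eq_mul]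
    ring
  have hnorm : ∀ t : ℝ, ‖e + t • m‖ ^ 2 = 1 + t ^ 2 := by
    intro t
    rw [← real_inner_self_eq_norm_sq]
    simp only [inner_add_left, inner_add_right, real_inner_smul_left, real_inner_smul_right, hee, hem, hme, hmm]
    ring
  have hinn : ∀ t : ℝ, ⟪e + t • m, e⟫ = 1 := by
    intro t
    simp only [inner_add_left, real_inner_smul_left, hee, hme]
    ring
  have h1 : ∀ t : ℝ, t ^ 2 < 2 → H e e + (H e m + H m e) * t + H m m * t ^ 2 ≤ 0 := by
    intro t ht
    rw [← hexp]
    exact hess_nonpos_of_coneSegregated hq hρ hseg (by rw [hnorm, hinn]; linarith)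
  have h2 : ∀ t : ℝ, 2 < t ^ 2 → 0 ≤ H e e + (H e m + H m e) * t + H m m * t ^ 2 := by
    intro t ht
    rw [← hexp]
    exact hess_nonneg_of_coneSegregated hq hρ hseg (by rw [hnorm, hinn]; linarith)
  obtain ⟨hB, hac⟩ := quad_coeffs_of_sign_change h1 h2
  -- back to `w`: `H e m = |w|⁻¹ H e w`, `H m e = |w|⁻¹ H w e`, `H m m = |w|⁻² H w w`
  have hwi : ‖w‖⁻¹ ≠ 0 := inv_ne_zero hwn.ne'
  have hem' : H e m = ‖w‖⁻¹ * H e w := by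
    rw [hm, map_smul, smul_eq_mul]
  have hme' : H m e = ‖w‖⁻¹ * H w e := by
    rw [hm, map_smul, smul_apply, smul_eq_mul]
  have hmm' : H m m = ‖w‖⁻¹ * (‖w‖⁻¹ * H w w) := by
    rw [hm]; simp only [map_smul, smul_apply, smul_eq_mul]
  constructor
  · rw [hem', hme', ← mul_add] at hB
    rcases mul_eq_zero.1 hB with h | h
    · exact absurd h hwi
    · exact h
  · rw [hmm'] at hac
    have hw2 : ‖w‖⁻¹ * ‖w‖⁻¹ * ‖w‖ ^ 2 = 1 := by field_simp
    have : H w w = (‖w‖⁻¹ * (‖w‖⁻¹ * H w w)) * ‖w‖ ^ 2 := by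
      rw [← mul_assoc, mul_comm, ← mul_assoc, mul_comm (‖w‖ ^ 2), hw2, one_mul]
    rw [this]
    have hsol : ‖w‖⁻¹ * (‖w‖⁻¹ * H w w) = -(H e e / 2) := by linarith
    rw [hsol]

/-- ★ RIGIDITY II (the Hessian is a compressed uniaxial quadrupole along `e`): under cone segregation,
`D²q(x)(v,v) = (a/2)(3⟨v,e⟩² − |v|²)` for every `v`, with `a = D²q(x)(e,e)`. -/
theorem hess_eq_of_coneSegregated (hq : ContDiff ℝ 2 q) (he : ‖e‖ = 1) (hρ : 0 < ρ)
    (hseg : ∀ z : EuclideanSpace ℝ (Fin 3), ‖z‖ < ρ →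
      (‖z‖ ^ 2 < 3 * ⟪z, e⟫ ^ 2 → q (x + z) ≤ q x) ∧ (3 * ⟪z, e⟫ ^ 2 < ‖z‖ ^ 2 → q x ≤ q (x + z)))
    (v : EuclideanSpace ℝ (Fin 3)) :
    fderiv ℝ (fderiv ℝ q) x v v = (fderiv ℝ (fderiv ℝ q) x e e / 2) * (3 * ⟪v, e⟫ ^ 2 - ‖v‖ ^ 2) := by
  set H := fderiv ℝ (fderiv ℝ q) x with hH
  have hee : ⟪e, e⟫ = 1 := by rw [real_inner_self_eq_norm_sq, he]; norm_num
  set w : EuclideanSpace ℝ (Fin 3) := v - ⟪v, e⟫ • e with hw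
  have hwe : ⟪w, e⟫ = 0 := by rw [hw, inner_sub_left, real_inner_smul_left, hee]; ring
  have hew : ⟪e, w⟫ = 0 := by rw [real_inner_comm]; exact hwe
  obtain ⟨hcross, hww⟩ := hess_perp_of_coneSegregated hq he hρ hseg hwe
  have hv : v = ⟪v, e⟫ • e + w := by rw [hw]; abel
  have hnv : ‖v‖ ^ 2 = ⟪v, e⟫ ^ 2 + ‖w‖ ^ 2 := by
    conv_lhs => rw [hv]
    rw [← real_inner_self_eq_norm_sq, inner_add_left, inner_add_right, inner_add_right,
      real_inner_smul_left, real_inner_smul_right, real_inner_smul_left, real_inner_smul_right,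
      hee, hew, hwe, real_inner_self_eq_norm_sq]
    ring
  have hexp : H v v = ⟪v, e⟫ ^ 2 * H e e + ⟪v, e⟫ * (H e w + H w e) + H w w := by
    conv_lhs => rw [hv]
    simp only [map_add, map_smul, add_apply, smul_apply, smul_eq_mul]
    ring
  rw [hexp, hcross, hww, hnv]
  ring

/-- ★ RIGIDITY II′: `a = D²q(x)(e,e) ≤ 0` (the quadrupole is COMPRESSED along `e`). -/
theorem hess_self_nonpos_of_coneSegregated (hq : ContDiff ℝ 2 q) (he : ‖e‖ = 1) (hρ : 0 < ρ)
    (hseg : ∀ z : EuclideanSpace ℝ (Fin 3), ‖z‖ < ρ →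
      (‖z‖ ^ 2 < 3 * ⟪z, e⟫ ^ 2 → q (x + z) ≤ q x) ∧ (3 * ⟪z, e⟫ ^ 2 < ‖z‖ ^ 2 → q x ≤ q (x + z))) :
    fderiv ℝ (fderiv ℝ q) x e e ≤ 0 := by
  have hee : ⟪e, e⟫ = 1 := by rw [real_inner_self_eq_norm_sq, he]; norm_num
  exact hess_nonpos_of_coneSegregated hq hρ hseg (by rw [he, hee]; norm_num)

/-- ★ RIGIDITY III: cone segregation forces `Δq(x) = 0` (the uniaxial quadrupole is trace-free). -/
theorem laplacian_eq_zero_of_coneSegregated (hq : ContDiff ℝ 2 q) (he : ‖e‖ = 1) (hρ : 0 < ρ)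
    (hseg : ∀ z : EuclideanSpace ℝ (Fin 3), ‖z‖ < ρ →
      (‖z‖ ^ 2 < 3 * ⟪z, e⟫ ^ 2 → q (x + z) ≤ q x) ∧ (3 * ⟪z, e⟫ ^ 2 < ‖z‖ ^ 2 → q x ≤ q (x + z))) :
    (Δ q) x = 0 := by
  rw [laplacian_eq_iteratedFDeriv_orthonormalBasis q (EuclideanSpace.basisFun (Fin 3) ℝ)]
  simp only [iteratedFDeriv_two_apply, Matrix.cons_val_zero, Matrix.cons_val_one]
  have hb : ∀ i : Fin 3, fderiv ℝ (fderiv ℝ q) x ((EuclideanSpace.basisFun (Fin 3) ℝ) i)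
      ((EuclideanSpace.basisFun (Fin 3) ℝ) i) =
      (fderiv ℝ (fderiv ℝ q) x e e / 2) * (3 * (e i) ^ 2 - 1) := by
    intro i
    have hn : ‖(EuclideanSpace.basisFun (Fin 3) ℝ) i‖ = 1 := (EuclideanSpace.basisFun (Fin 3) ℝ).orthonormal.1 i
    have hi : ⟪(EuclideanSpace.basisFun (Fin 3) ℝ) i, e⟫ = e i := by
      rw [EuclideanSpace.basisFun_apply, EuclideanSpace.inner_single_left]; simp
    rw [hess_eq_of_coneSegregated hq he hρ hseg, hn, hi]
    ring
  simp only [hb, ← Finset.mul_sum]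
  have hsum : ∑ i : Fin 3, (3 * (e i) ^ 2 - 1) = 3 * ‖e‖ ^ 2 - 3 := by
    rw [EuclideanSpace.norm_sq_eq, Finset.sum_sub_distrib, Finset.mul_sum]
    simp [Real.norm_eq_abs, sq_abs]
  rw [hsum, he]
  ring

/-- support (non-vacuity of the cone hypothesis, and sharpness of RIGIDITY II): the compressed uniaxial
quadrupole field `q(z) = |z|² − 3⟨z,e⟩²` itself is cone-segregated at `0` along `e` at every radius. -/
theorem coneSegregated_quadrupoleField (e : EuclideanSpace ℝ (Fin 3)) (ρ : ℝ) :
    ∀ z : EuclideanSpace ℝ (Fin 3), ‖z‖ < ρ →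
      (‖z‖ ^ 2 < 3 * ⟪z, e⟫ ^ 2 →
          (fun w : EuclideanSpace ℝ (Fin 3) => ‖w‖ ^ 2 - 3 * ⟪w, e⟫ ^ 2) (0 + z) ≤
            (fun w : EuclideanSpace ℝ (Fin 3) => ‖w‖ ^ 2 - 3 * ⟪w, e⟫ ^ 2) 0) ∧
        (3 * ⟪z, e⟫ ^ 2 < ‖z‖ ^ 2 →
          (fun w : EuclideanSpace ℝ (Fin 3) => ‖w‖ ^ 2 - 3 * ⟪w, e⟫ ^ 2) 0 ≤
            (fun w : EuclideanSpace ℝ (Fin 3) => ‖w‖ ^ 2 - 3 * ⟪w, e⟫ ^ 2) (0 + z)) := by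
  intro z _
  simp only [zero_add, norm_zero, inner_zero_left]
  constructor <;> intro h <;> nlinarith

end Cone

end Summit.NavierStokesRegularity.NavierStokesRegularity.Theorems.StrainDoors

end
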